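import Summits.RiemannHypothesis.RiemannHypothesis.Theorems.SuzukiThetaFlowUniformWindows

/-!
# SuzukiThetaFlowUniformWindowsB — two more θ-uniform clean windows (anchors θ₀ = 8 and θ₀ = 24) (column DBR; RH-FREE)

LINE 1 — LABEL: RH-FREE unconditional finite-window theorems about the explicit operator family `𝖪_θ[t]` ([Su20] (1.4));
bears_on: B-P(P2-flow) → B-P(P2).  WHAT THIS IS NOT: not a positivity statement about `ζ`, not evidence for or against RH;
every window below lies inside Column 2's certified Weil window `t ≤ 1` and is a finite instance of the `∀ t`-clause of
the RH-EQUIVALENT residual `AllWindowsWitness` (stmt-19733), never evidence for it; nothing here is progress toward RH.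

Companion of `Theorems.SuzukiThetaFlowUniformWindows` (anchors `θ₀ = 12`, `T = 1/2` and `θ₀ = 20`, `T = 21/25`).  The
polar-envelope certificates of eng-3 g4 for `θ = 8`, `T = 7/20` and `θ = 24`, `T = 19/20`
(`SuzukiWindowsDoorExplicitWindowPolarWindows.noUnitEigenvalue_limKernel_eight / _twentyFour'`, there at the
`NoUnitEigenvalue` level) are re-run through the operator-norm form `weightedSq_lt_one_of_rat_bounds` +
`opNorm_winOp_limKernel_lt_one` (same rational parameters), giving `‖𝖪₈[t]‖ < 1 ∀ t ≤ 7/20` and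
`‖𝖪₂₄[t]‖ < 1 ∀ t ≤ 19/20`, hence the anchors `Anchor 8 (7/20)`, `Anchor 24 (19/20)` and, by the θ-flow decay law on
Column 2's window (`uniformCleanWindow_of_anchor`), the UNCONDITIONAL θ-uniform clean windows
**`∀ θ ≥ 8, CleanUpTo θ (7/20)`** and **`∀ θ ≥ 24, CleanUpTo θ (19/20)`** — beyond the kernel's polar scale law
`t ≤ (θ−1)/28` exactly for `θ ∈ (8, 10.8)` resp. `θ ∈ (24, 27.6)`.

References: [Su20] M. Suzuki, ASPM 84 (2020) = arXiv:1907.07302, (1.4), Thm 1.2 (K-v).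
-/

noncomputable section

-- D-0017: `Summit.<S>.<S>.…` is the designed namespace of a single-problem summit.
set_option linter.dupNamespace false

open MeasureTheory Set

namespace Summit.RiemannHypothesis.RiemannHypothesis.Theorems.SuzukiThetaFlow

open Literature.NumberTheory.LFunctions
open Summit.RiemannHypothesis.RiemannHypothesis.Theorems.SuzukiCleanRadius (CleanUpTo)
open Summit.RiemannHypothesis.RiemannHypothesis.Theorems.SuzukiWindowsDoorExplicitOpNorm

/-- RH-FREE · **θ = 8: `‖𝖪₈[t]‖ < 1` for every `t ≤ 7/20`** (any bounded realisation on `L²(−t,t)`; eng-3 g4's polar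
certificate `σ₀ = 9` in operator-norm form). -/
theorem opNorm_winOp_limKernel_eight_lt_one {t : ℝ} (ht : t ≤ 7 / 20)
    {A : Lp ℝ 2 (volume.restrict (Ioo (-t) t)) →L[ℝ] Lp ℝ 2 (volume.restrict (Ioo (-t) t))}
    (hA : ∀ φ, (A φ : ℝ → ℝ) =ᵐ[volume.restrict (Ioo (-t) t)]
      fun x => ∫ y in Ioo (-t) t, limKernel 8 (x + y) * φ y) :
    ‖A‖ < 1 := by
  have h := weightedSq_lt_one_of_rat_bounds (n := 8) (m := 9) (N := 24) (by norm_num)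
    (by norm_num) (T := 7 / 20) (p := 3.1416) (q := 2.7182818286) (r := 37689 / 50000)
    (α := 225737 / 500000) (θe := 88 / 25) Real.pi_lt_d4.le Real.exp_one_lt_d9.le (by norm_num)
    (by norm_num) (by rw [Real.sqrt_le_left (by norm_num)]; norm_num) (by norm_num) (by norm_num)
    (by norm_num) (by norm_num) (by norm_num) (by norm_num)
    (by norm_num [Finset.sum_range_succ, Nat.factorial])
  have h' : ∫ u in (0 : ℝ)..(2 * (7 / 20)), (2 * (7 / 20) - u) * limKernel 8 u ^ 2 < 1 := by exact_mod_cast h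
  exact opNorm_winOp_limKernel_lt_one (θ := 8) (by norm_num) h' ht hA

/-- RH-FREE · **θ = 24: `‖𝖪₂₄[t]‖ < 1` for every `t ≤ 19/20`** (eng-3 g4's polar certificate `σ₀ = 12` in operator-norm
form). -/
theorem opNorm_winOp_limKernel_twentyFour_lt_one {t : ℝ} (ht : t ≤ 19 / 20)
    {A : Lp ℝ 2 (volume.restrict (Ioo (-t) t)) →L[ℝ] Lp ℝ 2 (volume.restrict (Ioo (-t) t))}
    (hA : ∀ φ, (A φ : ℝ → ℝ) =ᵐ[volume.restrict (Ioo (-t) t)]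
      fun x => ∫ y in Ioo (-t) t, limKernel 24 (x + y) * φ y) :
    ‖A‖ < 1 := by
  have h := weightedSq_lt_one_of_rat_bounds (n := 24) (m := 12) (N := 30) (by norm_num)
    (by norm_num) (T := 19 / 20) (p := 3.1416) (q := 2.7182818286) (r := 4949 / 12500)
    (α := 219029 / 1000000) (θe := 168744 / 13225) Real.pi_lt_d4.le Real.exp_one_lt_d9.le (by norm_num)
    (by norm_num) (by rw [Real.sqrt_le_left (by norm_num)]; norm_num) (by norm_num) (by norm_num)
    (by norm_num) (by norm_num) (by norm_num) (by norm_num)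
    (by norm_num [Finset.sum_range_succ, Nat.factorial])
  have h' : ∫ u in (0 : ℝ)..(2 * (19 / 20)), (2 * (19 / 20) - u) * limKernel 24 u ^ 2 < 1 := by exact_mod_cast h
  exact opNorm_winOp_limKernel_lt_one (θ := 24) (by norm_num) h' ht hA

/-- RH-FREE · `Anchor 8 (7/20)`. -/
theorem anchor_eight : Anchor 8 (7 / 20) :=
  anchor_of_opNorm_lt_one (by norm_num) fun _ ht _ hA => opNorm_winOp_limKernel_eight_lt_one ht hA

/-- RH-FREE · `Anchor 24 (19/20)`. -/
theorem anchor_twentyFour : Anchor 24 (19 / 20) :=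
  anchor_of_opNorm_lt_one (by norm_num) fun _ ht _ hA => opNorm_winOp_limKernel_twentyFour_lt_one ht hA

/-- **RH-FREE · UNCONDITIONAL θ-UNIFORM CLEAN WINDOW `∀ θ ≥ 8, CleanUpTo θ (7/20)`** (one kernel anchor at `θ = 8` +
the decay law + `weilPositivityOn_one`).  New kernel content for `θ ∈ (8, 10.8)`.  Nothing here bears on RH. -/
theorem uniformCleanWindow_eight : UniformCleanWindow 8 (7 / 20) :=
  uniformCleanWindow_of_anchor (by norm_num) (by norm_num) anchor_eight

/-- **RH-FREE · UNCONDITIONAL θ-UNIFORM CLEAN WINDOW `∀ θ ≥ 24, CleanUpTo θ (19/20)`** (one kernel anchor at `θ = 24` +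
the decay law + `weilPositivityOn_one`).  New kernel content for `θ ∈ (24, 27.6)`.  Nothing here bears on RH. -/
theorem uniformCleanWindow_twentyFour : UniformCleanWindow 24 (19 / 20) :=
  uniformCleanWindow_of_anchor (by norm_num) (by norm_num) anchor_twentyFour

/-- RH-FREE · spelled out: `θ ≥ 8`, `0 ≤ t ≤ 7/20` ⇒ `NoUnitEigenvalue (limKernel θ) t`. -/
theorem noUnitEigenvalue_of_eight_le {θ t : ℝ} (hθ : 8 ≤ θ) (ht0 : 0 ≤ t) (ht : t ≤ 7 / 20) :
    NoUnitEigenvalue (limKernel θ) t :=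
  uniformCleanWindow_eight θ hθ t ht0 ht

/-- RH-FREE · spelled out: `θ ≥ 24`, `0 ≤ t ≤ 19/20` ⇒ `NoUnitEigenvalue (limKernel θ) t`. -/
theorem noUnitEigenvalue_of_twentyFour_le {θ t : ℝ} (hθ : 24 ≤ θ) (ht0 : 0 ≤ t) (ht : t ≤ 19 / 20) :
    NoUnitEigenvalue (limKernel θ) t :=
  uniformCleanWindow_twentyFour θ hθ t ht0 ht

end Summit.RiemannHypothesis.RiemannHypothesis.Theorems.SuzukiThetaFlow

end
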